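import Mathlib

/-!
# The derivative functional as a linear form on coefficient space (crux `BeyondHessianNs`)

Helper file for crux item stmt-ValiantsHypothesis-5641 (`RefutationDegree.BeyondHessianNs`),
stub `stub_derivFunctional` (plumbing step W1) of the line `Sketch`.

For a point `y : σ → ℂ` (`σ = Fin n × Fin n`), a variable `e : σ` and a degree bound `d`, the
linear functional `g ↦ (∂_e g)(y)` on polynomials `g` of total degree `≤ d` is ONE polynomial `L`
of total degree `≤ 1` in the coefficient variables `X_μ` (`μ : σ →₀ ℕ`), with complex
coefficients, valid over every commutative ring `K` receiving `ℂ` via a ring map `φ`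
("`L(g)`" meaning `eval₂ φ (fun μ => coeff μ g) L`):

`L = Σ_{μ ∈ S_d} (∂_e x^μ)(y) · X_μ`, where `S_d = ⋃_{k ≤ d} univ.finsuppAntidiag k` is the finite
set of exponents of degree `≤ d`.

Proof of the identity `L(g) = (∂_e g)(φ ∘ y)`: `g = Σ_{μ ∈ S_d} g_μ x^μ` (`MvPolynomial.as_sum` and
`supp g ⊆ S_d` by `MvPolynomial.le_totalDegree`), `pderiv e` and `eval` are additive, and
`(∂_e (c · x^μ))(φ ∘ y) = φ ((∂_e x^μ)(y)) · c` (`pderiv_monomial`, `eval_monomial`).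
-/

noncomputable section

-- single-conjunct layout: Sub = Summit, duplicated namespace component intended
set_option linter.dupNamespace false

namespace Summit.ValiantsHypothesis.ValiantsHypothesis.Theorems.RefutationDegreeBeyondHessianNs

open MvPolynomial

section General

variable {σ : Type*} {K : Type*} [CommRing K]

/-- Membership in the finite set of exponents of degree `≤ d`:
`μ ∈ ⋃_{k < d + 1} univ.finsuppAntidiag k ↔ |μ| ≤ d`. [folklore] -/
theorem mem_biUnion_finsuppAntidiag_iff [Fintype σ] [DecidableEq σ] (d : ℕ) (μ : σ →₀ ℕ) :
    μ ∈ (Finset.range (d + 1)).biUnion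
        (fun k => (Finset.univ : Finset σ).finsuppAntidiag k) ↔
      (μ.sum fun _ k => k) ≤ d := by
  simp only [Finset.mem_biUnion, Finset.mem_range, Finset.mem_finsuppAntidiag',
    Finset.subset_univ, and_true]
  constructor
  · rintro ⟨k, hk, rfl⟩
    exact Nat.lt_succ_iff.mp hk
  · intro h
    exact ⟨_, Nat.lt_succ_iff.mpr h, rfl⟩

/-- A polynomial of total degree `≤ d` is supported on the exponents of degree `≤ d`.
[folklore] -/
theorem support_subset_biUnion_finsuppAntidiag [Fintype σ] [DecidableEq σ] {d : ℕ}
    {g : MvPolynomial σ K} (hg : g.totalDegree ≤ d) :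
    g.support ⊆ (Finset.range (d + 1)).biUnion
        (fun k => (Finset.univ : Finset σ).finsuppAntidiag k) := fun _ hμ =>
  (mem_biUnion_finsuppAntidiag_iff _ _).mpr ((le_totalDegree hμ).trans hg)

/-- A polynomial is the sum of its terms over any finite set of exponents containing its support
(cf. `MvPolynomial.as_sum`). [folklore] -/
theorem sum_monomial_coeff_eq_of_support_subset {S : Finset (σ →₀ ℕ)} {g : MvPolynomial σ K}
    (hS : g.support ⊆ S) : ∑ μ ∈ S, monomial μ (coeff μ g) = g := by
  conv_rhs => rw [g.as_sum]
  exact (Finset.sum_subset hS fun μ _ hμ => by rw [notMem_support_iff.mp hμ, monomial_zero]).symm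

/-- Functoriality of `(∂_e (c · x^μ))(y)` in the coefficient ring:
`(∂_e (c · x^μ))(φ ∘ y) = φ ((∂_e x^μ)(y)) · c`. [folklore] -/
theorem eval_pderiv_monomial_eq (φ : ℂ →+* K) (y : σ → ℂ) (e : σ) (μ : σ →₀ ℕ) (c : K) :
    eval (fun s => φ (y s)) (pderiv e (monomial μ c)) =
      φ (eval y (pderiv e (monomial μ (1 : ℂ)))) * c := by
  rw [pderiv_monomial, pderiv_monomial, eval_monomial, eval_monomial, one_mul, map_mul,
    map_natCast, map_finsuppProd]
  simp only [map_pow]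
  ring

end General

/-- **W1 — the derivative functional** `g ↦ (∂_e g)(y)` on polynomials of degree `≤ d` is a
linear form in the coefficients with complex coefficients, functorial in the coefficient ring:
`L = Σ_{|μ| ≤ d} (∂_e x^μ)(y) · X_μ` (stub `stub_derivFunctional` of the line `Sketch`).
[folklore] -/
theorem stub_derivFunctional : ∀ (n d : ℕ) (y : Fin n × Fin n → ℂ) (e : Fin n × Fin n),
    ∃ L : MvPolynomial (Fin n × Fin n →₀ ℕ) ℂ, L.totalDegree ≤ 1 ∧
      ∀ (K : Type) [CommRing K] (φ : ℂ →+* K) (g : MvPolynomial (Fin n × Fin n) K),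
        g.totalDegree ≤ d →
          MvPolynomial.eval₂ φ (fun μ => MvPolynomial.coeff μ g) L =
            MvPolynomial.eval (fun s => φ (y s)) (MvPolynomial.pderiv e g) := by
  intro n d y e
  refine ⟨∑ μ ∈ (Finset.range (d + 1)).biUnion
      (fun k => (Finset.univ : Finset (Fin n × Fin n)).finsuppAntidiag k),
      C (eval y (pderiv e (monomial μ (1 : ℂ)))) * X μ, ?_, ?_⟩
  · refine totalDegree_finsetSum_le fun μ _ => (totalDegree_mul _ _).trans ?_
    rw [totalDegree_C, totalDegree_X, zero_add]
  · intro K _ φ g hg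
    rw [eval₂_sum]
    simp only [eval₂_mul, eval₂_C, eval₂_X]
    conv_rhs =>
      rw [← sum_monomial_coeff_eq_of_support_subset (support_subset_biUnion_finsuppAntidiag hg),
        map_sum, map_sum]
    exact Finset.sum_congr rfl fun μ _ => (eval_pderiv_monomial_eq φ y e μ _).symm

end Summit.ValiantsHypothesis.ValiantsHypothesis.Theorems.RefutationDegreeBeyondHessianNs
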